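import Summits.AnomalousDissipation.AnomalousDissipation.Theorems.TaylorCertificatePair.Negative.Bounds

/-!
# The pure-real endgame (`s = ν^{-1/4}`)

Crux `TaylorCertificates.TaylorCertificatePair` (stmt-AnomalousDissipation-13037), negative side
(cdisprove seat `refuter-cdisprove-stmt-AnomalousDissipation-13037-0`): support for the refutation
`Theorems/TaylorCertificatesTaylorCertificatePairRefutation.lean` (CEILING killed by an unresolved beat).
All statements are written over the tree's objects directly (no new definitions): single real modes
`Torus.realTrigPoly {k} (fun _ => z) = Re (e_k • z)`, mode sums `∑ₘ Torus.realTrigPoly {k m} (fun _ => z m)`,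
Fourier coefficients `mFourierCoeff (complexify ∘ ·)`, the transversal products `(fun j => (κ j : ℂ)) ⬝ᵥ z`.

With `c₁ = 1 + 4π²√2`, `K₃ = √((2C+1)³)`, `k₅ = πF²/(4√2K₃)`, `c₃ = C²+2C+5`, `A = |E| + 6ΘF² + 72π²Θc₃²F²` and the
threshold `S₀ = 2 + 2c₁F/k₅ + 2(|E| + (2√2+8π²)ΘF²)/F² + 4c₁A/(k₅F)` (all written out), `endgame`: the shear
consequence `F²s⁸ − E − (2√2+8π²)ΘF²s⁴ ≤ c₁F𝔊` and the beat consequence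
`(π/(4√2))F²s⁸𝔊/√#ball ≤ E + c₁F𝔊 + 6ΘF²s⁴ + 72π²Θ(N²+2N+5)²F²s⁴` are incompatible for `s ≥ S₀`; plus
`multiplier_large`, `gain_lower`, `sum_norm_three_le` and small real-analysis facts used by the assembly.
-/

noncomputable section

open MeasureTheory UnitAddTorus Matrix
open scoped InnerProductSpace ENNReal ComplexConjugate

namespace Summit.AnomalousDissipation.AnomalousDissipation.Theorems.TaylorCertificatePair.Negative

open Literature.Analysis.FunctionSpaces Literature.Analysis.FluidPDE

/-! ### The pure-real endgame -/

/-- `c₁ > 0`. -/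
theorem c₁_pos : 0 < (1 + 4 * Real.pi ^ 2 * Real.sqrt 2) := by positivity

/-- `K₃ > 0`. -/
theorem K₃_pos {C : ℝ} (hC : 0 ≤ C) : 0 < (Real.sqrt ((2 * (C) + 1) ^ 3)) :=
  Real.sqrt_pos.2 (by positivity)

/-- `k₅ > 0`. -/
theorem k₅_pos {F C : ℝ} (hF : 0 < F) (hC : 0 ≤ C) : 0 < (Real.pi / (4 * Real.sqrt 2) * (F) ^ 2 / (Real.sqrt ((2 * ((C)) + 1) ^ 3))) := by
  have := K₃_pos hC; positivity

/-- `A ≥ 0`. -/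
theorem Acost_nonneg {F E C Θ : ℝ} (hΘ : 0 ≤ Θ) : 0 ≤ (|E| + 6 * (Θ) * (F) ^ 2 + 72 * Real.pi ^ 2 * (Θ) * ((((C)) ^ 2 + 2 * ((C)) + 5)) ^ 2 * (F) ^ 2) := by
  positivity

/-- `S₀ ≥ 2`. -/
theorem two_le_S₀ {F E C Θ : ℝ} (hF : 0 < F) (hC : 0 ≤ C) (hΘ : 0 ≤ Θ) : 2 ≤ (2 + 2 * (1 + 4 * Real.pi ^ 2 * Real.sqrt 2) * (F) / (Real.pi / (4 * Real.sqrt 2) * ((F)) ^ 2 / (Real.sqrt ((2 * (((C))) + 1) ^ 3))) + 2 * (|E| + (2 * Real.sqrt 2 + 8 * Real.pi ^ 2) * (Θ) * (F) ^ 2) / (F) ^ 2 + 4 * (1 + 4 * Real.pi ^ 2 * Real.sqrt 2) * (|(E)| + 6 * ((Θ)) * ((F)) ^ 2 + 72 * Real.pi ^ 2 * ((Θ)) * (((((C))) ^ 2 + 2 * (((C))) + 5)) ^ 2 * ((F)) ^ 2) / ((Real.pi / (4 * Real.sqrt 2) * ((F)) ^ 2 / (Real.sqrt ((2 * (((C)))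 + 1) ^ 3))) * (F))) := by
  have h1 := k₅_pos hF hC
  have h2 := c₁_pos
  have h3 := Acost_nonneg (F := F) (E := E) (C := C) hΘ
  have h4 : 0 ≤ |E| + (2 * Real.sqrt 2 + 8 * Real.pi ^ 2) * Θ * F ^ 2 := by positivity
  have : 0 ≤ 2 * (1 + 4 * Real.pi ^ 2 * Real.sqrt 2) * F / (Real.pi / (4 * Real.sqrt 2) * (F) ^ 2 / (Real.sqrt ((2 * ((C)) + 1) ^ 3))) := by positivity
  have : 0 ≤ 2 * (|E| + (2 * Real.sqrt 2 + 8 * Real.pi ^ 2) * Θ * F ^ 2) / F ^ 2 := by positivity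
  have : 0 ≤ 4 * (1 + 4 * Real.pi ^ 2 * Real.sqrt 2) * (|E| + 6 * (Θ) * (F) ^ 2 + 72 * Real.pi ^ 2 * (Θ) * ((((C)) ^ 2 + 2 * ((C)) + 5)) ^ 2 * (F) ^ 2) / ((Real.pi / (4 * Real.sqrt 2) * (F) ^ 2 / (Real.sqrt ((2 * ((C)) + 1) ^ 3))) * F) := by positivity
  linarith

/-- **Endgame.** The two consequences of the CEILING (at the far shear state and at the beat state)
are incompatible once `s = ν^{-1/4} ≥ S₀`. -/
theorem endgame {F E C Θ s N card Np 𝔊 : ℝ} (hF : 0 < F) (hΘ : 0 ≤ Θ) (hC : 0 ≤ C)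
    (hs : (2 + 2 * (1 + 4 * Real.pi ^ 2 * Real.sqrt 2) * (F) / (Real.pi / (4 * Real.sqrt 2) * ((F)) ^ 2 / (Real.sqrt ((2 * (((C))) + 1) ^ 3))) + 2 * (|E| + (2 * Real.sqrt 2 + 8 * Real.pi ^ 2) * (Θ) * (F) ^ 2) / (F) ^ 2 + 4 * (1 + 4 * Real.pi ^ 2 * Real.sqrt 2) * (|(E)| + 6 * ((Θ)) * ((F)) ^ 2 + 72 * Real.pi ^ 2 * ((Θ)) * (((((C))) ^ 2 + 2 * (((C))) + 5)) ^ 2 * ((F)) ^ 2) / ((Real.pi / (4 * Real.sqrt 2) * ((F)) ^ 2 / (Real.sqrt ((2 * (((C))) + 1) ^ 3))) * (F))) ≤ s) (hN0 : 0 ≤ N) (hN : N ≤ C * s ^ 2) (hcard1 : 1 ≤ card)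
    (hcard : card ≤ (2 * N + 1) ^ 3) (hNp : Np = N ^ 2 + 2 * N + 5) (h𝔊 : 0 ≤ 𝔊)
    (hI : F ^ 2 * s ^ 8 - E - (2 * Real.sqrt 2 + 8 * Real.pi ^ 2) * Θ * F ^ 2 * s ^ 4 ≤ (1 + 4 * Real.pi ^ 2 * Real.sqrt 2) * F * 𝔊)
    (hII : Real.pi / (4 * Real.sqrt 2) * F ^ 2 * s ^ 8 * 𝔊 / Real.sqrt card ≤
      E + (1 + 4 * Real.pi ^ 2 * Real.sqrt 2) * F * 𝔊 + 6 * Θ * F ^ 2 * s ^ 4 + 72 * Real.pi ^ 2 * Θ * Np ^ 2 * F ^ 2 * s ^ 4) :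
    False := by
  have hs2 : 2 ≤ s := (two_le_S₀ (E := E) hF hC hΘ).trans hs
  have hs1 : 1 ≤ s := by linarith
  have hs0 : 0 < s := by linarith
  have hk₅ := k₅_pos hF hC
  have hK₃ := K₃_pos hC
  have hc₁ := c₁_pos
  have hA := Acost_nonneg (F := F) (E := E) (C := C) hΘ
  have hF2 : 0 < F ^ 2 := by positivity
  have hs4 : 1 ≤ s ^ 4 := one_le_pow₀ hs1
  have hs2' : 1 ≤ s ^ 2 := one_le_pow₀ hs1
  have hs24 : s ^ 2 ≤ s ^ 4 := pow_le_pow_right₀ hs1 (by norm_num)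
  have hs14 : s ≤ s ^ 4 := by
    calc s = s ^ 1 := (pow_one s).symm
      _ ≤ s ^ 4 := pow_le_pow_right₀ hs1 (by norm_num)
  have hs15 : s ≤ s ^ 5 := by
    calc s = s ^ 1 := (pow_one s).symm
      _ ≤ s ^ 5 := pow_le_pow_right₀ hs1 (by norm_num)
  have hs4_12 : s ^ 4 ≤ s ^ 12 := pow_le_pow_right₀ hs1 (by norm_num)
  have hs0_12 : (1 : ℝ) ≤ s ^ 12 := one_le_pow₀ hs1
  -- (1) `√card ≤ K₃ s³`
  have hcard3 : card ≤ (2 * C + 1) ^ 3 * (s ^ 3) ^ 2 := by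
    have h1 : 2 * N + 1 ≤ (2 * C + 1) * s ^ 2 := by linarith
    have h2 : (2 * N + 1) ^ 3 ≤ ((2 * C + 1) * s ^ 2) ^ 3 :=
      pow_le_pow_left₀ (by positivity) h1 3
    calc card ≤ (2 * N + 1) ^ 3 := hcard
      _ ≤ ((2 * C + 1) * s ^ 2) ^ 3 := h2
      _ = (2 * C + 1) ^ 3 * (s ^ 3) ^ 2 := by ring
  have hsqrt : Real.sqrt card ≤ (Real.sqrt ((2 * (C) + 1) ^ 3)) * s ^ 3 := by
    calc Real.sqrt card ≤ Real.sqrt ((2 * C + 1) ^ 3 * (s ^ 3) ^ 2) := Real.sqrt_le_sqrt hcard3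
      _ = (Real.sqrt ((2 * (C) + 1) ^ 3)) * s ^ 3 := by
          rw [Real.sqrt_mul (by positivity), Real.sqrt_sq (by positivity)]
  have hsqrt_pos : 0 < Real.sqrt card := Real.sqrt_pos.2 (by linarith)
  -- (2) gain ≥ `k₅ s⁵ 𝔊`
  have hgain : (Real.pi / (4 * Real.sqrt 2) * (F) ^ 2 / (Real.sqrt ((2 * ((C)) + 1) ^ 3))) * s ^ 5 * 𝔊 ≤
      Real.pi / (4 * Real.sqrt 2) * F ^ 2 * s ^ 8 * 𝔊 / Real.sqrt card := by
    rw [le_div_iff₀ hsqrt_pos]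
    calc (Real.pi / (4 * Real.sqrt 2) * (F) ^ 2 / (Real.sqrt ((2 * ((C)) + 1) ^ 3))) * s ^ 5 * 𝔊 * Real.sqrt card
        ≤ (Real.pi / (4 * Real.sqrt 2) * (F) ^ 2 / (Real.sqrt ((2 * ((C)) + 1) ^ 3))) * s ^ 5 * 𝔊 * ((Real.sqrt ((2 * (C) + 1) ^ 3)) * s ^ 3) :=
          mul_le_mul_of_nonneg_left hsqrt (by positivity)
      _ = Real.pi / (4 * Real.sqrt 2) * F ^ 2 * s ^ 8 * 𝔊 := by
          field_simp
  -- (3) `Np ≤ c₃ s⁴`, cost `≤ A s¹²`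
  have hNp_le : Np ≤ ((C) ^ 2 + 2 * (C) + 5) * s ^ 4 := by
    have h1 : N ^ 2 ≤ C ^ 2 * s ^ 4 := by
      calc N ^ 2 ≤ (C * s ^ 2) ^ 2 := pow_le_pow_left₀ hN0 hN 2
        _ = C ^ 2 * s ^ 4 := by ring
    have h2 : N ≤ C * s ^ 4 := hN.trans (mul_le_mul_of_nonneg_left hs24 hC)
    have h3 : ((C) ^ 2 + 2 * (C) + 5) * s ^ 4 = C ^ 2 * s ^ 4 + 2 * (C * s ^ 4) + 5 * s ^ 4 := by ring
    rw [hNp, h3]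
    linarith
  have hNp0 : 0 ≤ Np := by rw [hNp]; positivity
  have hNp2 : Np ^ 2 ≤ (((C) ^ 2 + 2 * (C) + 5)) ^ 2 * s ^ 8 := by
    calc Np ^ 2 ≤ (((C) ^ 2 + 2 * (C) + 5) * s ^ 4) ^ 2 := pow_le_pow_left₀ hNp0 hNp_le 2
      _ = (((C) ^ 2 + 2 * (C) + 5)) ^ 2 * s ^ 8 := by ring
  have hcost : E + 6 * Θ * F ^ 2 * s ^ 4 + 72 * Real.pi ^ 2 * Θ * Np ^ 2 * F ^ 2 * s ^ 4 ≤
      (|E| + 6 * (Θ) * (F) ^ 2 + 72 * Real.pi ^ 2 * (Θ) * ((((C)) ^ 2 + 2 * ((C)) + 5)) ^ 2 * (F) ^ 2) * s ^ 12 := by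
    have e1 : E ≤ |E| * s ^ 12 := by
      calc E ≤ |E| := le_abs_self E
        _ = |E| * 1 := (mul_one _).symm
        _ ≤ |E| * s ^ 12 := mul_le_mul_of_nonneg_left hs0_12 (abs_nonneg E)
    have e2c : 6 * Θ * F ^ 2 * s ^ 4 ≤ 6 * Θ * F ^ 2 * s ^ 12 :=
      mul_le_mul_of_nonneg_left hs4_12 (by positivity)
    have e3 : 72 * Real.pi ^ 2 * Θ * Np ^ 2 * F ^ 2 * s ^ 4 ≤
        72 * Real.pi ^ 2 * Θ * ((((C) ^ 2 + 2 * (C) + 5)) ^ 2 * s ^ 8) * F ^ 2 * s ^ 4 := by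
      gcongr
    have e4 : (|E| + 6 * (Θ) * (F) ^ 2 + 72 * Real.pi ^ 2 * (Θ) * ((((C)) ^ 2 + 2 * ((C)) + 5)) ^ 2 * (F) ^ 2) * s ^ 12 =
        |E| * s ^ 12 + 6 * Θ * F ^ 2 * s ^ 12 +
          72 * Real.pi ^ 2 * Θ * ((((C) ^ 2 + 2 * (C) + 5)) ^ 2 * s ^ 8) * F ^ 2 * s ^ 4 := by
      ring
    rw [e4]
    linarith
  -- (4) from (II): `(k₅ s⁵ - c₁F) 𝔊 ≤ A s¹²`
  have h4 : (Real.pi / (4 * Real.sqrt 2) * (F) ^ 2 / (Real.sqrt ((2 * ((C)) + 1) ^ 3))) * s ^ 5 * 𝔊 - (1 + 4 * Real.pi ^ 2 * Real.sqrt 2) * F * 𝔊 ≤ (|E| + 6 * (Θ) * (F) ^ 2 + 72 * Real.pi ^ 2 * (Θ) * ((((C)) ^ 2 + 2 * ((C)) + 5)) ^ 2 * (F) ^ 2) * s ^ 12 := by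
    linarith [hgain, hII, hcost]
  -- (5) `k₅ s⁵ ≥ 2 c₁ F` from `s ≥ 2c₁F/k₅`
  have hpos1 : 0 ≤ 2 * (1 + 4 * Real.pi ^ 2 * Real.sqrt 2) * F / (Real.pi / (4 * Real.sqrt 2) * (F) ^ 2 / (Real.sqrt ((2 * ((C)) + 1) ^ 3))) := by positivity
  have hpos2 : 0 ≤ 2 * (|E| + (2 * Real.sqrt 2 + 8 * Real.pi ^ 2) * Θ * F ^ 2) / F ^ 2 := by
    positivity
  have hpos3 : 0 ≤ 4 * (1 + 4 * Real.pi ^ 2 * Real.sqrt 2) * (|E| + 6 * (Θ) * (F) ^ 2 + 72 * Real.pi ^ 2 * (Θ) * ((((C)) ^ 2 + 2 * ((C)) + 5)) ^ 2 * (F) ^ 2) / ((Real.pi / (4 * Real.sqrt 2) * (F) ^ 2 / (Real.sqrt ((2 * ((C)) + 1) ^ 3))) * F) := by positivity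
  have hS0 : (2 + 2 * (1 + 4 * Real.pi ^ 2 * Real.sqrt 2) * (F) / (Real.pi / (4 * Real.sqrt 2) * ((F)) ^ 2 / (Real.sqrt ((2 * (((C))) + 1) ^ 3))) + 2 * (|E| + (2 * Real.sqrt 2 + 8 * Real.pi ^ 2) * (Θ) * (F) ^ 2) / (F) ^ 2 + 4 * (1 + 4 * Real.pi ^ 2 * Real.sqrt 2) * (|(E)| + 6 * ((Θ)) * ((F)) ^ 2 + 72 * Real.pi ^ 2 * ((Θ)) * (((((C))) ^ 2 + 2 * (((C))) + 5)) ^ 2 * ((F)) ^ 2) / ((Real.pi / (4 * Real.sqrt 2) * ((F)) ^ 2 / (Real.sqrt ((2 * (((C))) + 1) ^ 3))) * (F))) = 2 + 2 * (1 + 4 * Real.pi ^ 2 * Real.sqrt 2) * F / (Real.pi / (4 * Real.sqrt 2) * (F) ^ 2 / (Real.sqrt ((2 * ((C)) + 1) ^ 3))) +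
      2 * (|E| + (2 * Real.sqrt 2 + 8 * Real.pi ^ 2) * Θ * F ^ 2) / F ^ 2 +
      4 * (1 + 4 * Real.pi ^ 2 * Real.sqrt 2) * (|E| + 6 * (Θ) * (F) ^ 2 + 72 * Real.pi ^ 2 * (Θ) * ((((C)) ^ 2 + 2 * ((C)) + 5)) ^ 2 * (F) ^ 2) / ((Real.pi / (4 * Real.sqrt 2) * (F) ^ 2 / (Real.sqrt ((2 * ((C)) + 1) ^ 3))) * F) := rfl
  have hS1 : 2 * (1 + 4 * Real.pi ^ 2 * Real.sqrt 2) * F / (Real.pi / (4 * Real.sqrt 2) * (F) ^ 2 / (Real.sqrt ((2 * ((C)) + 1) ^ 3))) ≤ s := by linarith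
  have h5 : 2 * (1 + 4 * Real.pi ^ 2 * Real.sqrt 2) * F ≤ (Real.pi / (4 * Real.sqrt 2) * (F) ^ 2 / (Real.sqrt ((2 * ((C)) + 1) ^ 3))) * s ^ 5 := by
    rw [div_le_iff₀ hk₅] at hS1
    have := mul_le_mul_of_nonneg_left hs15 hk₅.le
    linarith
  -- (6) from (I): `F² s⁸ ≤ 2 c₁ F 𝔊`
  have hS2 : 2 * (|E| + (2 * Real.sqrt 2 + 8 * Real.pi ^ 2) * Θ * F ^ 2) / F ^ 2 ≤ s := by linarith
  have h6a : 2 * (|E| + (2 * Real.sqrt 2 + 8 * Real.pi ^ 2) * Θ * F ^ 2) ≤ F ^ 2 * s ^ 4 := by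
    rw [div_le_iff₀ hF2] at hS2
    have := mul_le_mul_of_nonneg_left hs14 hF2.le
    linarith
  have h6 : F ^ 2 * s ^ 8 ≤ 2 * (1 + 4 * Real.pi ^ 2 * Real.sqrt 2) * F * 𝔊 := by
    have hB : 0 ≤ (2 * Real.sqrt 2 + 8 * Real.pi ^ 2) * Θ * F ^ 2 := by positivity
    have hs4nn : 0 ≤ s ^ 4 := by positivity
    have h6b := mul_le_mul_of_nonneg_right h6a hs4nn
    have hE : E ≤ |E| * s ^ 4 := by
      calc E ≤ |E| := le_abs_self E
        _ = |E| * 1 := (mul_one _).symm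
        _ ≤ |E| * s ^ 4 := mul_le_mul_of_nonneg_left hs4 (abs_nonneg E)
    have e8 : F ^ 2 * s ^ 4 * s ^ 4 = F ^ 2 * s ^ 8 := by ring
    have e9 : 2 * (|E| + (2 * Real.sqrt 2 + 8 * Real.pi ^ 2) * Θ * F ^ 2) * s ^ 4 =
        2 * (|E| * s ^ 4) + 2 * ((2 * Real.sqrt 2 + 8 * Real.pi ^ 2) * Θ * F ^ 2 * s ^ 4) := by
      ring
    rw [e8, e9] at h6b
    linarith
  -- (7) combine: `(k₅ s⁵/2) (F s⁸) ≤ 2 c₁ A s¹²`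
  have hx : (Real.pi / (4 * Real.sqrt 2) * (F) ^ 2 / (Real.sqrt ((2 * ((C)) + 1) ^ 3))) * s ^ 5 / 2 ≤ (Real.pi / (4 * Real.sqrt 2) * (F) ^ 2 / (Real.sqrt ((2 * ((C)) + 1) ^ 3))) * s ^ 5 - (1 + 4 * Real.pi ^ 2 * Real.sqrt 2) * F := by linarith
  have hy : F * s ^ 8 ≤ 2 * (1 + 4 * Real.pi ^ 2 * Real.sqrt 2) * 𝔊 := by
    have h' : F * (F * s ^ 8) ≤ F * (2 * (1 + 4 * Real.pi ^ 2 * Real.sqrt 2) * 𝔊) := by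
      have e : F * (F * s ^ 8) = F ^ 2 * s ^ 8 := by ring
      have e' : F * (2 * (1 + 4 * Real.pi ^ 2 * Real.sqrt 2) * 𝔊) = 2 * (1 + 4 * Real.pi ^ 2 * Real.sqrt 2) * F * 𝔊 := by ring
      rw [e, e']; exact h6
    exact le_of_mul_le_mul_left h' hF
  have hcF : 0 ≤ (1 + 4 * Real.pi ^ 2 * Real.sqrt 2) * F := by positivity
  have h7 : (Real.pi / (4 * Real.sqrt 2) * (F) ^ 2 / (Real.sqrt ((2 * ((C)) + 1) ^ 3))) * s ^ 5 / 2 * (F * s ^ 8) ≤ ((Real.pi / (4 * Real.sqrt 2) * (F) ^ 2 / (Real.sqrt ((2 * ((C)) + 1) ^ 3))) * s ^ 5 - (1 + 4 * Real.pi ^ 2 * Real.sqrt 2) * F) * (2 * (1 + 4 * Real.pi ^ 2 * Real.sqrt 2) * 𝔊) :=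
    mul_le_mul hx hy (by positivity) (by linarith [h5])
  have h8 : (Real.pi / (4 * Real.sqrt 2) * (F) ^ 2 / (Real.sqrt ((2 * ((C)) + 1) ^ 3))) * F * s ^ 13 ≤ 4 * (1 + 4 * Real.pi ^ 2 * Real.sqrt 2) * (|E| + 6 * (Θ) * (F) ^ 2 + 72 * Real.pi ^ 2 * (Θ) * ((((C)) ^ 2 + 2 * ((C)) + 5)) ^ 2 * (F) ^ 2) * s ^ 12 := by
    have e : ((Real.pi / (4 * Real.sqrt 2) * (F) ^ 2 / (Real.sqrt ((2 * ((C)) + 1) ^ 3))) * s ^ 5 - (1 + 4 * Real.pi ^ 2 * Real.sqrt 2) * F) * (2 * (1 + 4 * Real.pi ^ 2 * Real.sqrt 2) * 𝔊) =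
        2 * (1 + 4 * Real.pi ^ 2 * Real.sqrt 2) * ((Real.pi / (4 * Real.sqrt 2) * (F) ^ 2 / (Real.sqrt ((2 * ((C)) + 1) ^ 3))) * s ^ 5 * 𝔊 - (1 + 4 * Real.pi ^ 2 * Real.sqrt 2) * F * 𝔊) := by ring
    rw [e] at h7
    have h4' := mul_le_mul_of_nonneg_left h4 (by positivity : (0 : ℝ) ≤ 2 * (1 + 4 * Real.pi ^ 2 * Real.sqrt 2))
    have e2c : (Real.pi / (4 * Real.sqrt 2) * (F) ^ 2 / (Real.sqrt ((2 * ((C)) + 1) ^ 3))) * s ^ 5 / 2 * (F * s ^ 8) = (Real.pi / (4 * Real.sqrt 2) * (F) ^ 2 / (Real.sqrt ((2 * ((C)) + 1) ^ 3))) * F * s ^ 13 / 2 := by ring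
    rw [e2c] at h7
    linarith
  -- (8) contradiction with `s ≥ 2 + 4 c₁ A / (k₅ F)`
  have hS3 : 4 * (1 + 4 * Real.pi ^ 2 * Real.sqrt 2) * (|E| + 6 * (Θ) * (F) ^ 2 + 72 * Real.pi ^ 2 * (Θ) * ((((C)) ^ 2 + 2 * ((C)) + 5)) ^ 2 * (F) ^ 2) / ((Real.pi / (4 * Real.sqrt 2) * (F) ^ 2 / (Real.sqrt ((2 * ((C)) + 1) ^ 3))) * F) ≤ s - 2 := by linarith
  rw [div_le_iff₀ (by positivity)] at hS3
  have h9 : (Real.pi / (4 * Real.sqrt 2) * (F) ^ 2 / (Real.sqrt ((2 * ((C)) + 1) ^ 3))) * F * s ≤ 4 * (1 + 4 * Real.pi ^ 2 * Real.sqrt 2) * (|E| + 6 * (Θ) * (F) ^ 2 + 72 * Real.pi ^ 2 * (Θ) * ((((C)) ^ 2 + 2 * ((C)) + 5)) ^ 2 * (F) ^ 2) := by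
    have hs12 : 0 < s ^ 12 := by positivity
    have : (Real.pi / (4 * Real.sqrt 2) * (F) ^ 2 / (Real.sqrt ((2 * ((C)) + 1) ^ 3))) * F * s * s ^ 12 ≤ 4 * (1 + 4 * Real.pi ^ 2 * Real.sqrt 2) * (|E| + 6 * (Θ) * (F) ^ 2 + 72 * Real.pi ^ 2 * (Θ) * ((((C)) ^ 2 + 2 * ((C)) + 5)) ^ 2 * (F) ^ 2) * s ^ 12 := by
      have e : (Real.pi / (4 * Real.sqrt 2) * (F) ^ 2 / (Real.sqrt ((2 * ((C)) + 1) ^ 3))) * F * s * s ^ 12 = (Real.pi / (4 * Real.sqrt 2) * (F) ^ 2 / (Real.sqrt ((2 * ((C)) + 1) ^ 3))) * F * s ^ 13 := by ring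
      rw [e]; exact h8
    exact le_of_mul_le_mul_right this hs12
  have hkF : 0 < (Real.pi / (4 * Real.sqrt 2) * (F) ^ 2 / (Real.sqrt ((2 * ((C)) + 1) ^ 3))) * F := mul_pos hk₅ hF
  have e : (s - 2) * ((Real.pi / (4 * Real.sqrt 2) * (F) ^ 2 / (Real.sqrt ((2 * ((C)) + 1) ^ 3))) * F) = (Real.pi / (4 * Real.sqrt 2) * (F) ^ 2 / (Real.sqrt ((2 * ((C)) + 1) ^ 3))) * F * s - 2 * ((Real.pi / (4 * Real.sqrt 2) * (F) ^ 2 / (Real.sqrt ((2 * ((C)) + 1) ^ 3))) * F) := by ring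
  rw [e] at hS3
  linarith


/-! ### Small pieces of real analysis for the assembly -/

/-- `(s⁻⁴)^{-1/2} = s²` for `s > 0`. -/
theorem rpow_neg_half_inv_pow_four {s : ℝ} (hs : 0 < s) : ((s ^ 4)⁻¹ : ℝ) ^ (-(1 / 2 : ℝ)) = s ^ 2 := by
  have h4 : 0 ≤ s ^ 4 := by positivity
  rw [Real.rpow_neg (inv_nonneg.2 h4), Real.inv_rpow h4, inv_inv, ← Real.sqrt_eq_rpow,
    show s ^ 4 = (s ^ 2) ^ 2 by ring, Real.sqrt_sq (by positivity)]

/-- From the shear consequence and `s ≥ S₀`: the multiplier is large, in particular positive. -/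
theorem multiplier_large {F E C Θ s 𝔊 : ℝ} (hF : 0 < F) (hΘ : 0 ≤ Θ) (hC : 0 ≤ C)
    (hs : (2 + 2 * (1 + 4 * Real.pi ^ 2 * Real.sqrt 2) * (F) / (Real.pi / (4 * Real.sqrt 2) * ((F)) ^ 2 / (Real.sqrt ((2 * (((C))) + 1) ^ 3))) + 2 * (|E| + (2 * Real.sqrt 2 + 8 * Real.pi ^ 2) * (Θ) * (F) ^ 2) / (F) ^ 2 + 4 * (1 + 4 * Real.pi ^ 2 * Real.sqrt 2) * (|(E)| + 6 * ((Θ)) * ((F)) ^ 2 + 72 * Real.pi ^ 2 * ((Θ)) * (((((C))) ^ 2 + 2 * (((C))) + 5)) ^ 2 * ((F)) ^ 2) / ((Real.pi / (4 * Real.sqrt 2) * ((F)) ^ 2 / (Real.sqrt ((2 * (((C))) + 1) ^ 3))) * (F))) ≤ s)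
    (hI : F ^ 2 * s ^ 8 - E - (2 * Real.sqrt 2 + 8 * Real.pi ^ 2) * Θ * F ^ 2 * s ^ 4 ≤ (1 + 4 * Real.pi ^ 2 * Real.sqrt 2) * F * 𝔊) :
    F ^ 2 * s ^ 8 ≤ 2 * (1 + 4 * Real.pi ^ 2 * Real.sqrt 2) * F * 𝔊 := by
  have hs2 : 2 ≤ s := (two_le_S₀ (E := E) hF hC hΘ).trans hs
  have hs1 : 1 ≤ s := by linarith
  have hk₅ := k₅_pos hF hC
  have hF2 : 0 < F ^ 2 := by positivity
  have hs4 : 1 ≤ s ^ 4 := one_le_pow₀ hs1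
  have hs14 : s ≤ s ^ 4 := by
    calc s = s ^ 1 := (pow_one s).symm
      _ ≤ s ^ 4 := pow_le_pow_right₀ hs1 (by norm_num)
  have hpos1 : 0 ≤ 2 * (1 + 4 * Real.pi ^ 2 * Real.sqrt 2) * F / (Real.pi / (4 * Real.sqrt 2) * (F) ^ 2 / (Real.sqrt ((2 * ((C)) + 1) ^ 3))) := by have := c₁_pos; positivity
  have hpos3 : 0 ≤ 4 * (1 + 4 * Real.pi ^ 2 * Real.sqrt 2) * (|E| + 6 * (Θ) * (F) ^ 2 + 72 * Real.pi ^ 2 * (Θ) * ((((C)) ^ 2 + 2 * ((C)) + 5)) ^ 2 * (F) ^ 2) / ((Real.pi / (4 * Real.sqrt 2) * (F) ^ 2 / (Real.sqrt ((2 * ((C)) + 1) ^ 3))) * F) := by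
    have := c₁_pos; have := Acost_nonneg (F := F) (E := E) (C := C) hΘ; positivity
  have hS0 : (2 + 2 * (1 + 4 * Real.pi ^ 2 * Real.sqrt 2) * (F) / (Real.pi / (4 * Real.sqrt 2) * ((F)) ^ 2 / (Real.sqrt ((2 * (((C))) + 1) ^ 3))) + 2 * (|E| + (2 * Real.sqrt 2 + 8 * Real.pi ^ 2) * (Θ) * (F) ^ 2) / (F) ^ 2 + 4 * (1 + 4 * Real.pi ^ 2 * Real.sqrt 2) * (|(E)| + 6 * ((Θ)) * ((F)) ^ 2 + 72 * Real.pi ^ 2 * ((Θ)) * (((((C))) ^ 2 + 2 * (((C))) + 5)) ^ 2 * ((F)) ^ 2) / ((Real.pi / (4 * Real.sqrt 2) * ((F)) ^ 2 / (Real.sqrt ((2 * (((C))) + 1) ^ 3))) * (F))) = 2 + 2 * (1 + 4 * Real.pi ^ 2 * Real.sqrt 2) * F / (Real.pi / (4 * Real.sqrt 2) * (F) ^ 2 / (Real.sqrt ((2 * ((C)) + 1) ^ 3))) +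
      2 * (|E| + (2 * Real.sqrt 2 + 8 * Real.pi ^ 2) * Θ * F ^ 2) / F ^ 2 +
      4 * (1 + 4 * Real.pi ^ 2 * Real.sqrt 2) * (|E| + 6 * (Θ) * (F) ^ 2 + 72 * Real.pi ^ 2 * (Θ) * ((((C)) ^ 2 + 2 * ((C)) + 5)) ^ 2 * (F) ^ 2) / ((Real.pi / (4 * Real.sqrt 2) * (F) ^ 2 / (Real.sqrt ((2 * ((C)) + 1) ^ 3))) * F) := rfl
  have hS2 : 2 * (|E| + (2 * Real.sqrt 2 + 8 * Real.pi ^ 2) * Θ * F ^ 2) / F ^ 2 ≤ s := by linarith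
  have h6a : 2 * (|E| + (2 * Real.sqrt 2 + 8 * Real.pi ^ 2) * Θ * F ^ 2) ≤ F ^ 2 * s ^ 4 := by
    rw [div_le_iff₀ hF2] at hS2
    have := mul_le_mul_of_nonneg_left hs14 hF2.le
    linarith
  have hB : 0 ≤ (2 * Real.sqrt 2 + 8 * Real.pi ^ 2) * Θ * F ^ 2 := by positivity
  have hs4nn : 0 ≤ s ^ 4 := by positivity
  have h6b := mul_le_mul_of_nonneg_right h6a hs4nn
  have hE : E ≤ |E| * s ^ 4 := by
    calc E ≤ |E| := le_abs_self E
      _ = |E| * 1 := (mul_one _).symm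
      _ ≤ |E| * s ^ 4 := mul_le_mul_of_nonneg_left hs4 (abs_nonneg E)
  have e8 : F ^ 2 * s ^ 4 * s ^ 4 = F ^ 2 * s ^ 8 := by ring
  have e9 : 2 * (|E| + (2 * Real.sqrt 2 + 8 * Real.pi ^ 2) * Θ * F ^ 2) * s ^ 4 =
      2 * (|E| * s ^ 4) + 2 * ((2 * Real.sqrt 2 + 8 * Real.pi ^ 2) * Θ * F ^ 2 * s ^ 4) := by ring
  rw [e8, e9] at h6b
  linarith

/-- The sum of the three polarisation norms. -/
theorem sum_norm_three_le {F ν : ℝ} (hF : 0 < F) (hν : 0 < ν) {zA zB : (EuclideanSpace ℂ (Fin 3))}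
    (hzA : ‖zA‖ ≤ F / (2 * ν)) (hzB : ‖zB‖ ≤ F / (2 * ν)) :
    ∑ m, ‖(![((((F) / (ν) * Real.sqrt 2 : ℝ) : ℂ) • (EuclideanSpace.complexify (EuclideanSpace.single (0 : Fin 3) (1 : ℝ)) : EuclideanSpace ℂ (Fin 3))), zA, zB] : Fin 3 → (EuclideanSpace ℂ (Fin 3))) m‖ ≤ 3 * F / ν := by
  simp only [Fin.sum_univ_three, Matrix.cons_val_zero, Matrix.cons_val_one, Matrix.cons_val_two,
    Matrix.head_cons, Matrix.tail_cons, Fin.isValue]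
  rw [norm_zsh hF.le hν]
  have : F / ν * Real.sqrt 2 ≤ F / ν * (3 / 2) := mul_le_mul_of_nonneg_left
    (show Real.sqrt 2 ≤ 3 / 2 by rw [Real.sqrt_le_left (by norm_num)]; norm_num) (by positivity)
  have e : F / ν * (3 / 2) + F / (2 * ν) + F / (2 * ν) = 3 * F / ν - F / (2 * ν) := by field_simp; ring
  have hpos : 0 ≤ F / (2 * ν) := by positivity
  linarith

/-- **The gain of the beat** in terms of the truncated norm:
`(π/(4√2)) F² s⁸ 𝔊 / √#ball ≤ π α² √|q|² |ζ|` with `α = F s⁴/2`. -/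
theorem gain_lower {F s 𝔊 card gnorm ζn fq : ℝ} (h𝔊 : 0 ≤ 𝔊)
    (hcard : 1 ≤ card) (hg : 𝔊 ^ 2 ≤ card * gnorm ^ 2) (hgn : 0 ≤ gnorm) (hζ : gnorm ^ 2 ≤ 2 * ζn ^ 2)
    (hζn : 0 ≤ ζn) (hfq : 1 ≤ fq) :
    Real.pi / (4 * Real.sqrt 2) * F ^ 2 * s ^ 8 * 𝔊 / Real.sqrt card ≤
      Real.pi * (F * s ^ 4 / 2) * (F * s ^ 4 / 2) * Real.sqrt fq * ζn := by
  have hsc : 0 < Real.sqrt card := Real.sqrt_pos.2 (by linarith)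
  have h2 : 0 < Real.sqrt 2 := Real.sqrt_pos.2 (by norm_num)
  have hg1 : 𝔊 ≤ Real.sqrt card * gnorm := by
    calc 𝔊 = Real.sqrt (𝔊 ^ 2) := (Real.sqrt_sq h𝔊).symm
      _ ≤ Real.sqrt (card * gnorm ^ 2) := Real.sqrt_le_sqrt hg
      _ = Real.sqrt card * gnorm := by rw [Real.sqrt_mul (by linarith), Real.sqrt_sq hgn]
  have hg2 : gnorm ≤ Real.sqrt 2 * ζn := by
    calc gnorm = Real.sqrt (gnorm ^ 2) := (Real.sqrt_sq hgn).symm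
      _ ≤ Real.sqrt (2 * ζn ^ 2) := Real.sqrt_le_sqrt hζ
      _ = Real.sqrt 2 * ζn := by rw [Real.sqrt_mul (by norm_num), Real.sqrt_sq hζn]
  have key : 𝔊 / Real.sqrt card ≤ Real.sqrt 2 * ζn := by
    rw [div_le_iff₀ hsc]
    calc 𝔊 ≤ Real.sqrt card * gnorm := hg1
      _ ≤ Real.sqrt card * (Real.sqrt 2 * ζn) := mul_le_mul_of_nonneg_left hg2 (Real.sqrt_nonneg _)
      _ = Real.sqrt 2 * ζn * Real.sqrt card := by ring
  have hsfq : 1 ≤ Real.sqrt fq := Real.one_le_sqrt.2 hfq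
  calc Real.pi / (4 * Real.sqrt 2) * F ^ 2 * s ^ 8 * 𝔊 / Real.sqrt card
      = Real.pi / (4 * Real.sqrt 2) * F ^ 2 * s ^ 8 * (𝔊 / Real.sqrt card) := by ring
    _ ≤ Real.pi / (4 * Real.sqrt 2) * F ^ 2 * s ^ 8 * (Real.sqrt 2 * ζn) :=
        mul_le_mul_of_nonneg_left key (by positivity)
    _ = Real.pi / 4 * F ^ 2 * s ^ 8 * ζn * 1 := by field_simp
    _ ≤ Real.pi / 4 * F ^ 2 * s ^ 8 * ζn * Real.sqrt fq :=
        mul_le_mul_of_nonneg_left hsfq (by positivity)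
    _ = Real.pi * (F * s ^ 4 / 2) * (F * s ^ 4 / 2) * Real.sqrt fq * ζn := by ring

end Summit.AnomalousDissipation.AnomalousDissipation.Theorems.TaylorCertificatePair.Negative
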